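import Summits.BirchSwinnertonDyer.BirchSwinnertonDyer.Theorems.CMKolyvaginAtInertTwoMinusPartDescentAtTwoPow
import Summits.BirchSwinnertonDyer.BirchSwinnertonDyer.Theorems.ErratumRoadFiveNonSurjCornerKolyJLevelOneAvatar
import Summits.BirchSwinnertonDyer.BirchSwinnertonDyer.Theorems.ErratumRoadFiveNonSurjCornerKolyJLevelTransport
import Summits.BirchSwinnertonDyer.BirchSwinnertonDyer.Theorems.GenusKolyvaginAtTwoVisiblePairAtTwoInjective
import Literature.NumberTheory.EllipticCurves.TwoTorsionOddDegreeBaseChangeProofs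
import HarnessLib

/-!
# Route `CMKolyvaginAtInertTwo`, crux `CMKolyvaginConjectureAtInertTwo` (stmt-BirchSwinnertonDyer-24648),
# stub `stub_positiveDepth` — THE ROOT CLASS OF THE KERNEL KOLYVAGIN MACHINE AT `p = 2`:
# McCallum's class `c_{2^M}(Q)` of a `2^{m₁}`-th ROOT `Q` of a machine point `P_n` at the LOW level `2^M`,
# with `ι_* c_{2^M}(Q) = c_{2^{M+m₁}}(n)`, the same `τ`-sign and CARTESIAN Selmer conditions; and the exact
# order of `δ_{2^L} y_K` (the bottom bit the Čebotarev leaf places)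

Seat `leafhand-bsd-cmkolyvaginatinert-7` g0 (cell `bsd-eis`); helper `--supports stmt-BirchSwinnertonDyer-24648`;
the toolkit of the refined `(−ε)`-descent `…MinusPartRefinedDescentAtTwoPow` (director-bsd (858)(c), brief L1).
THEOREMS ONLY: no definition, no named fact, no `sorry`; nothing is closed; BSD is proved for no curve.

WHAT (McCallum 1991 §5, before Prop. 5.2: when `p^{M_r} ∣ P_n` the class `c_M(n)` is read through the root).
In the machine's abstract currency (`A ≤ E(K̄)` admissible = "`E(K_n)`", `P ∈ invPoints A q'` = "`[P_n]`
invariant mod `q'`", `kolyvaginClass` = McCallum's cocycle class, Literature `HeegnerPointsKolyvaginPrimaryClassesProofs`):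
* §1 `isAdmissible_of_dvd`, `mem_invPoints_of_zsmul_eq` — along `q ∣ q' = k·q` admissibility descends and a
  `k`-th root `Q ∈ A` of `P` is invariant mod `q` (both from "no `q'`-torsion in `A`", McCallum (5)).
* §2 `exists_rootClass_two_pow` — for `q = 2^M`, `q' = 2^{M+m₁}`, `2^{m₁} Q = P`: a class `d ∈ H¹(K, E[2^M])`
  with `ι_* d = c_{2^{M+m₁}}(P)` (tree `Koly.torsionH1OfDvd_kolyvaginClass_of_zsmul`: the SAME cocycle), the same
  `Gal(K/ℚ)`-sign as `c_{2^{M+m₁}}(P)` (`ι_*` injective as `E(K)[2] = 0`: `ρ̄_{E,2}` onto, `K` imaginary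
  quadratic; `conjAct_eq_smul_of_torsionH1OfDvd`) and, at EVERY `K`-field `E`, `k·d` Selmer at `E` iff
  `k·c_{2^{M+m₁}}(P)` is (`mem_selmerLocalKer_iff_torsionH1OfDvd_mem`: the local Kummer kernel is cartesian).
* §3 `two_zsmul_bottomBit_kummer_eq_zero` / `bottomBit_kummer_ne_zero` — with `2^{M₀} ∣ y` and `2^{M₀+1} ∤ y`
  in `E(K)` (`E(K)[2] = 0`) and `M₀ < L`, the class `2^{L−M₀−1}·δ_{2^L}(y)` is a NON-ZERO class killed by `2`
  (`δ_{2^L} y` has exact order `2^{L−M₀}`; McCallum Lemma 5.1).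

HONEST FRAMING: bookkeeping on the machine's data; no Heegner point, no curve-specific input; the refined descent
that uses it is the next file.  References: [McCallumLMS1991] §4 (4)–(6), Lemma 4.1, Lemma 4.6, §5 Lemma 5.1 and
the paragraph before Prop. 5.2; [GrossLMS1991] §4 (4.4)–(4.6), Prop. 5.3.
presearch: tree re-keying (`lean search 'rootClass'`: the `p`-odd / X₀(N)-datum twins `Walk.torsionH1OfDvd_rootClass`,
`exists_levelOne_avatar`); print = McCallum §5 (`p` odd) [corpus: book:editornd-l-functions-arithmetic p0285].
-/

-- single-conjunct summit: `Summit.BirchSwinnertonDyer.BirchSwinnertonDyer.…` repeats the name by design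
set_option linter.dupNamespace false
set_option autoImplicit false

noncomputable section

open scoped Classical
open WeierstrassCurve NumberField IsDedekindDomain Field
open Literature.NumberTheory.GaloisRepresentations Literature.NumberTheory.EllipticCurves
open Literature.NumberTheory.EllipticCurves.KolyvaginCocycle
open Summit.BirchSwinnertonDyer.Rank1Residual (X11b.Three.Koly.torsionH1OfDvd_kolyvaginClass_of_zsmul)
open Summit.BirchSwinnertonDyer.BirchSwinnertonDyer.Theorems.GenusExact (VisiblePairAtTwo.torsionH1OfDvd_pow_injective)

namespace Summit.BirchSwinnertonDyer.BirchSwinnertonDyer.Theorems.KolyvaginDescentTwo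

/-! ## §1 McCallum's data under a change of level `q ∣ q'` -/

section Root

variable {G : Type*} [Group G] {V : Type*} [AddCommGroup V] [DistribMulAction G V]

/-- **Admissibility descends along `q ∣ q'`**: a `G`-stable subgroup without `q'`-torsion has no `q`-torsion.
[cite: McCallumLMS1991, §4 (5)] -/
theorem isAdmissible_of_dvd {A : AddSubgroup V} {q q' : ℤ} (hA : IsAdmissible G A q') (hqq' : q ∣ q') :
    IsAdmissible G A q := by
  obtain ⟨k, rfl⟩ := hqq'
  refine ⟨hA.smul_mem, fun a ha h0 ↦ hA.eq_zero_of_zsmul ha ?_⟩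
  rw [mul_comm, mul_smul, h0, smul_zero]

/-- **A `k`-th root `Q ∈ A` of a point `P` invariant mod `q'·A`, `q' = k·q`, is invariant mod `q·A`**:
from `(g−1)P = q'R` we get `k·((g−1)Q − qR) = 0` in the torsion-free `A`, so `(g−1)Q = qR`
(McCallum §5: "`p^{M_r} ∣ P_n`" makes `c_M(n)` a class of the root). [cite: McCallumLMS1991, §4 (4), (5), §5 Lemma 5.1] -/
theorem mem_invPoints_of_zsmul_eq {A : AddSubgroup V} {q q' k : ℤ} (hA : IsAdmissible G A q')
    (hqq' : q' = k * q) {Q P : V} (hQ : Q ∈ A) (hQP : k • Q = P) (hP : P ∈ invPoints G A q') :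
    Q ∈ invPoints G A q := by
  refine ⟨hQ, fun g ↦ ?_⟩
  obtain ⟨R, hR, hRe⟩ := hP.2 g
  refine ⟨R, hR, ?_⟩
  have hmem : g • Q - Q - q • R ∈ A := A.sub_mem (A.sub_mem (hA.smul_mem g hQ) hQ) (A.zsmul_mem hR q)
  have hk : k • (g • Q - Q - q • R) = 0 := by
    rw [zsmul_sub, zsmul_sub, ← smul_zsmul_comm, hQP, smul_smul, ← hqq', hRe, sub_self]
  have h0 : g • Q - Q - q • R = 0 := hA.eq_zero_of_zsmul hmem (by
    rw [hqq', mul_comm, mul_smul, hk, smul_zero])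
  rw [sub_eq_zero] at h0
  exact h0.symm

end Root

/-! ## §2 The root class at the low level `2^M` -/

variable (W : WeierstrassCurve ℚ) {K : Type} [Field K] [NumberField K]

/-- **The root class.**  `E/ℚ` with `ρ̄_{E,2}` onto, `K` imaginary quadratic (so `E(K)[2] = 0` and
`ι_* : H¹(K, E[2^M]) → H¹(K, E[2^{M+m₁}])` is injective); `A ≤ E(K̄)` admissible at `2^{M+m₁}`, `P ∈ A`
invariant mod `2^{M+m₁}`, and a ROOT `Q ∈ A`, `2^{m₁} Q = P`.  Then there is `d ∈ H¹(K, E[2^M])` — McCallum's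
class of `Q` at level `2^M` — with (i) `ι_* d = c_{2^{M+m₁}}(P)`, (ii) `c_* d = ν d` whenever
`c_* c_{2^{M+m₁}}(P) = ν c_{2^{M+m₁}}(P)` (`c ∈ Gal(K/ℚ)`), (iii) for every `K`-field `E` and `k ∈ ℤ`:
`k·d ∈ ker(H¹(K, E[2^M]) → H¹(E, E))` iff `k·c_{2^{M+m₁}}(P) ∈ ker(H¹(K, E[2^{M+m₁}]) → H¹(E, E))`.
[cite: McCallumLMS1991, §4 (4)–(6), Lemma 4.1, Lemma 4.6, §5 (before Prop. 5.2)] [cite: GrossLMS1991, §4 (4.4)–(4.6), Prop. 5.3] -/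
theorem exists_rootClass_two_pow [W.IsElliptic] (hK : IsImaginaryQuadratic K)
    (hρ : W.HasSurjectiveModNGaloisRep 2) (c : K ≃ₐ[ℚ] K) {M m₁ : ℕ}
    (hdiv : ∀ T : geomPoints (W.baseChange K), ∃ R, ((2 ^ M : ℕ) : ℤ) • R = T)
    (hdiv' : ∀ T : geomPoints (W.baseChange K), ∃ R, ((2 ^ (M + m₁) : ℕ) : ℤ) • R = T)
    {A : AddSubgroup (geomPoints (W.baseChange K))}
    (hA : IsAdmissible (absoluteGaloisGroup K) A ((2 ^ (M + m₁) : ℕ) : ℤ))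
    {P : geomPoints (W.baseChange K)}
    (hP : P ∈ invPoints (absoluteGaloisGroup K) A ((2 ^ (M + m₁) : ℕ) : ℤ))
    {Q : geomPoints (W.baseChange K)} (hQA : Q ∈ A) (hQP : (((2 : ℕ) : ℤ) ^ m₁) • Q = P) {ν : ℤ}
    (hdeig : conjAct W c _ (kolyvaginClass (W.baseChange K) _ hdiv' hA P hP) =
      ν • kolyvaginClass (W.baseChange K) _ hdiv' hA P hP) :
    ∃ d : galH1Torsion (W.baseChange K) ((2 ^ M : ℕ) : ℤ),
      torsionH1OfDvd (W.baseChange K) (natCast_pow_dvd_natCast_pow_add 2 M m₁) d =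
          kolyvaginClass (W.baseChange K) _ hdiv' hA P hP ∧
        conjAct W c _ d = ν • d ∧
        ∀ (E : Type) [Field E] [Algebra K E] (k : ℤ),
          k • d ∈ selmerLocalKer (W.baseChange K) E ((2 ^ M : ℕ) : ℤ) ↔
            k • kolyvaginClass (W.baseChange K) _ hdiv' hA P hP ∈
              selmerLocalKer (W.baseChange K) E ((2 ^ (M + m₁) : ℕ) : ℤ) := by
  have hdvd : ((2 ^ M : ℕ) : ℤ) ∣ ((2 ^ (M + m₁) : ℕ) : ℤ) := natCast_pow_dvd_natCast_pow_add 2 M m₁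
  have hqq' : ((2 ^ (M + m₁) : ℕ) : ℤ) = (((2 : ℕ) : ℤ) ^ m₁) * ((2 ^ M : ℕ) : ℤ) := by
    push_cast; ring
  have hbot : AddSubgroup.torsionBy (W.baseChange K).toAffine.Point ((2 : ℕ) : ℤ) = ⊥ := by
    have h := torsionBy_two_baseChange_eq_bot_of_hasSurjectiveModNGaloisRep_two_of_isImaginaryQuadratic
      W hρ K hK
    simpa using h
  have hιinj : Function.Injective (torsionH1OfDvd (W.baseChange K) hdvd) :=
    VisiblePairAtTwo.torsionH1OfDvd_pow_injective (W.baseChange K) (p := 2) hbot hdvd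
  have hAq : IsAdmissible (absoluteGaloisGroup K) A ((2 ^ M : ℕ) : ℤ) := isAdmissible_of_dvd hA hdvd
  have hQinv : Q ∈ invPoints (absoluteGaloisGroup K) A ((2 ^ M : ℕ) : ℤ) :=
    mem_invPoints_of_zsmul_eq hA hqq' hQA hQP hP
  refine ⟨kolyvaginClass (W.baseChange K) _ hdiv hAq Q hQinv, ?_⟩
  have hιd : torsionH1OfDvd (W.baseChange K) hdvd (kolyvaginClass (W.baseChange K) _ hdiv hAq Q hQinv) =
      kolyvaginClass (W.baseChange K) _ hdiv' hA P hP :=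
    X11b.Three.Koly.torsionH1OfDvd_kolyvaginClass_of_zsmul (W.baseChange K) hdvd hqq' hdiv hdiv' hAq hA
      hQinv hQP hP
  refine ⟨hιd, conjAct_eq_smul_of_torsionH1OfDvd W c hdvd hιinj ν _ (by rw [hιd]; exact hdeig),
    fun E _ _ k ↦ ?_⟩
  rw [mem_selmerLocalKer_iff_torsionH1OfDvd_mem (W.baseChange K) E hdvd, map_zsmul, hιd]

/-! ## §3 The exact order of `δ_{2^L} y` from `2^{M₀} ∥ y` in `E(K)` -/

/-- **`2 · 2^{L−M₀−1} δ_{2^L}(y) = 0`** when `2^{M₀} ∣ y` in `E(K)` and `M₀ < L` (`δ_{2^L} = kummerMapTorsion`, kernel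
`2^L E(K)`). [cite: McCallumLMS1991, §5 Lemma 5.1] [cite: SilvermanAEC2009, VIII.§2 (Kummer sequence)] -/
theorem two_zsmul_bottomBit_kummer_eq_zero {L M₀ : ℕ} (hL : M₀ < L)
    (hdiv' : ∀ T : geomPoints (W.baseChange K), ∃ R, ((2 ^ L : ℕ) : ℤ) • R = T)
    {y : (W.baseChange K).toAffine.Point}
    (hM₀ : ∃ R : (W.baseChange K).toAffine.Point, (((2 : ℕ) : ℤ) ^ M₀) • R = y) :
    ((2 : ℕ) : ℤ) • ((((2 : ℕ) : ℤ) ^ (L - M₀ - 1)) • kummerMapTorsion (W.baseChange K) _ hdiv' y) = 0 := by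
  obtain ⟨R₀, hR₀⟩ := hM₀
  rw [smul_smul, ← pow_succ', show L - M₀ - 1 + 1 = L - M₀ by omega, ← map_zsmul, ← hR₀, smul_smul,
    ← pow_add, show L - M₀ + M₀ = L by omega]
  have hker : (((2 : ℕ) : ℤ) ^ L) • R₀ ∈ (kummerMapTorsion (W.baseChange K) _ hdiv').ker := by
    rw [kummerMapTorsion_ker, AddMonoidHom.mem_range]
    exact ⟨R₀, by rw [← Nat.cast_pow]; rfl⟩
  exact (AddMonoidHom.mem_ker).mp hker

/-- **`2^{L−M₀−1} δ_{2^L}(y) ≠ 0`** when `2^{M₀+1} ∤ y` in `E(K)`, `M₀ < L`, and `E(K)[2] = 0` (`ρ̄_{E,2}` onto, `K`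
imaginary quadratic): a `2^L`-th root `R` of `2^{L−M₀−1} y` would give `2^{L−M₀−1}(2^{M₀+1}R − y) = 0`.
[cite: McCallumLMS1991, §5 Lemma 5.1] [cite: SilvermanAEC2009, VIII.§2 (Kummer sequence)] -/
theorem bottomBit_kummer_ne_zero [W.IsElliptic] (hK : IsImaginaryQuadratic K)
    (hρ : W.HasSurjectiveModNGaloisRep 2) {L M₀ : ℕ} (hL : M₀ < L)
    (hdiv' : ∀ T : geomPoints (W.baseChange K), ∃ R, ((2 ^ L : ℕ) : ℤ) • R = T)
    {y : (W.baseChange K).toAffine.Point}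
    (hM₀' : ∀ R : (W.baseChange K).toAffine.Point, (((2 : ℕ) : ℤ) ^ (M₀ + 1)) • R ≠ y) :
    (((2 : ℕ) : ℤ) ^ (L - M₀ - 1)) • kummerMapTorsion (W.baseChange K) _ hdiv' y ≠ 0 := by
  -- `E(K)[2] = 0`, hence no `2`-power torsion in `E(K)`
  have hbot : AddSubgroup.torsionBy (W.baseChange K).toAffine.Point ((2 : ℕ) : ℤ) = ⊥ := by
    have h := torsionBy_two_baseChange_eq_bot_of_hasSurjectiveModNGaloisRep_two_of_isImaginaryQuadratic
      W hρ K hK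
    simpa using h
  have htf : ∀ (k : ℕ) (T : (W.baseChange K).toAffine.Point), (((2 : ℕ) : ℤ) ^ k) • T = 0 → T = 0 := by
    intro k
    induction k with
    | zero => intro T hT; rwa [pow_zero, one_smul] at hT
    | succ k ih =>
      intro T hT
      apply ih
      have hmem : (((2 : ℕ) : ℤ) ^ k) • T ∈
          AddSubgroup.torsionBy (W.baseChange K).toAffine.Point ((2 : ℕ) : ℤ) := by
        rw [Literature.NumberTheory.EllipticCurves.mem_torsionBy_iff, smul_smul, ← pow_succ', hT]
      rw [hbot, AddSubgroup.mem_bot] at hmem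
      exact hmem
  intro h0
  have hker : ((((2 : ℕ) : ℤ) ^ (L - M₀ - 1)) • y) ∈ (kummerMapTorsion (W.baseChange K) _ hdiv').ker := by
    rw [AddMonoidHom.mem_ker, map_zsmul, h0]
  rw [kummerMapTorsion_ker, AddMonoidHom.mem_range] at hker
  obtain ⟨R₀, hR₀⟩ := hker
  change ((2 ^ L : ℕ) : ℤ) • R₀ = (((2 : ℕ) : ℤ) ^ (L - M₀ - 1)) • y at hR₀
  refine hM₀' R₀ ?_
  have h0' : (((2 : ℕ) : ℤ) ^ (M₀ + 1)) • R₀ - y = 0 := by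
    refine htf (L - M₀ - 1) _ ?_
    rw [zsmul_sub, smul_smul, ← pow_add, show L - M₀ - 1 + (M₀ + 1) = L by omega, sub_eq_zero, ← hR₀,
      Nat.cast_pow]
  rw [sub_eq_zero] at h0'
  exact h0'

end Summit.BirchSwinnertonDyer.BirchSwinnertonDyer.Theorems.KolyvaginDescentTwo

end
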